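import Literature.NumberTheory.Automorphic.SmoothIndLevelActKernel
import Literature.NumberTheory.Automorphic.SmoothInductionAdmissibleOfCocompact
import Literature.NumberTheory.Automorphic.UnitaryGroupCMLocalIwasawa
import Literature.NumberTheory.Automorphic.LocalUnitaryGroupCongrMeasure
import Literature.NumberTheory.Automorphic.CMPrincipalSeriesJacquetEvalOne
import Literature.NumberTheory.Automorphic.HaarIntegralClosedCompactProofs
import Literature.NumberTheory.Automorphic.Liu2021.LemD1SplitPlaceOfFacts
import HarnessLib

/-!
# van Dijk's kernel formula for the principal series of `U(Φ_N)(L⁺_v)`: `tr i_G(χ)(f) = ∫_K C ∫_B f(k⁻¹ b k) χ(b) δ_B^{1∕2}(b) db dk`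
# (van Dijk 1972, Thm. p. 237; Bernstein–Zelevinsky 1977 §2.3; Rogawski 1990 §4.9, §12.2)

Topic `NumberTheory/Automorphic`; namespace `Literature.NumberTheory.Automorphic.UnitaryGroup`.  THEOREMS ONLY (no definition, no instance, no notation, no named fact,
no `sorry`).  Cell `pub/hodgecm-mathlib`, line «CMCharIdentityTest» (F0P3b), PLAN v14 §9 joint (vdG)∕(vdH) of (N-492) `stub_inducedCharTransfer` [Rogawski1990 Lemma 4.9.2]:
the UNITARY counterpart of ★ `GLn.exists_smoothTrace_parabolicIndGL_eq_integral_KMU` — the abstract kernel theorem ★ `Representation.smoothTrace_smoothIndRep_eq_integral_kernel_diag`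
(VD-3, any `G = H · K`) instantiated at `G = U(Φ_N)(L⁺_v) = ↥(unitaryGroupOfForm (conjLocal L c v) (cmLocalForm L N v))`, `H = B` (★ `cmBorelTriple`), `K` ANY compact open subgroup
with `G = B · K` (values-abstract: the consumer takes `K = K_v =` ★ `cmLocalIntegralLevel L N Φ_N v`, compact open by ★ `isCompact_isOpen_cmLocalIntegralLevel`, `G = B · K_v` at EVERY
finite `v` by ★ `exists_borel_mul_mem_cmLocalIntegralLevel`), with the `G = B · K` disintegration from ★ `HaarHK.integral_eq_mul_integral_integral_of_secondCountable`, Fubini-swapped.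
* `exists_integral_eq_mul_integral_compact_borel` — `∫_G F dν = C ∫_K ∫_B F(b k) dμ_B dμ_K` (`C > 0`, continuous compactly supported `F`, `K` compact with `G = B · K`).
* **`exists_smoothTrace_cmPrincipalSeries_eq_integral_KB`** — for ANY character `χ` of the diagonal torus, `K` compact open with `G = B · K`, and Haar `ν, μ_B, μ_K`:
  `∃ C > 0` (calibrated as above) with `(cmPrincipalSeries L N v χ).smoothTrace ν f = ∫_K C · ∫_B f(k⁻¹ b k) · χ(proj b) δ_B^{1∕2}(b) dμ_B dμ_K` for every locally constant
  compactly supported `f`.  [Next joints for (vdG): `B = T ⋉ N` and `∫_N f(k⁻¹ t n k) dn = ‖D(t)‖^{-1∕2}·(orbital integral)` — B-p12's Weyl-numerator currency.]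
HONEST LABEL: HC_CM is proved only modulo the printed citations (2 remaining named inputs hLiu418, h413) until rung 0 closes; this file pays no letter by itself.

## References
* [vanDijk1972] G. van Dijk, *Computation of certain induced characters of 𝔭-adic groups*, Math. Ann. 199 (1972), 229–240, Thm. p. 237.
* [BernsteinZelevinsky1977] I. N. Bernstein, A. V. Zelevinsky, *Induced representations of reductive 𝔭-adic groups I*, §2.3.
* [Rogawski1990] J. D. Rogawski, *Automorphic Representations of Unitary Groups in Three Variables* (1990), §4.5 p. 45, §4.9 p. 56, §12.2 p. 173.
-/

set_option autoImplicit false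

noncomputable section

open NumberField IsDedekindDomain MeasureTheory MeasureTheory.Measure Topology
open scoped MatrixGroups

namespace Literature.NumberTheory.Automorphic

namespace UnitaryGroup

variable (L : Type) [Field L] [NumberField L] [IsCMField L] (N : ℕ) (v : HeightOneSpectrum (𝓞 ↥(maximalRealSubfield L)))
  [MeasurableSpace ↥(unitaryGroupOfForm (conjLocal L (IsCMField.complexConj L) v) (cmLocalForm L N v))]
  [BorelSpace ↥(unitaryGroupOfForm (conjLocal L (IsCMField.complexConj L) v) (cmLocalForm L N v))]

/-- **`∫_{U(Φ_N)(L⁺_v)} F dν = C · ∫_K ∫_B F(b k) dμ_B dμ_K`** (`C > 0`) for continuous compactly supported `F`, a compact subgroup `K` with `G = B · K`, and Haar measures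
`ν, μ_B, μ_K` — the `G = B · K` disintegration (★ `HaarHK.integral_eq_mul_integral_integral_of_secondCountable`) with the inner integrals swapped by Fubini.  (At `K = K_v` use
★ `isCompact_isOpen_cmLocalIntegralLevel` and ★ `exists_borel_mul_mem_cmLocalIntegralLevel`.)
[cite: Rogawski1990, §4.5 p. 45] [cite: BernsteinZelevinsky1977, §2.3] -/
theorem exists_integral_eq_mul_integral_compact_borel
    (KU : Subgroup ↥(unitaryGroupOfForm (conjLocal L (IsCMField.complexConj L) v) (cmLocalForm L N v)))
    (hKUc : IsCompact (KU : Set ↥(unitaryGroupOfForm (conjLocal L (IsCMField.complexConj L) v) (cmLocalForm L N v))))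
    (hGK : ∀ g : ↥(unitaryGroupOfForm (conjLocal L (IsCMField.complexConj L) v) (cmLocalForm L N v)),
      ∃ h : ↥(cmBorelTriple L N v).P, ∃ κ ∈ KU, g = h * κ)
    (ν : Measure ↥(unitaryGroupOfForm (conjLocal L (IsCMField.complexConj L) v) (cmLocalForm L N v))) [ν.IsHaarMeasure]
    (μB : Measure ↥(cmBorelTriple L N v).P) [μB.IsHaarMeasure] (μK : Measure ↥KU) [μK.IsHaarMeasure] :
    ∃ C : ℝ, 0 < C ∧ ∀ F : ↥(unitaryGroupOfForm (conjLocal L (IsCMField.complexConj L) v) (cmLocalForm L N v)) → ℂ, Continuous F → HasCompactSupport F →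
      ∫ g, F g ∂ν = C * ∫ k : ↥KU,
        ∫ b : ↥(cmBorelTriple L N v).P, F ((b : ↥(unitaryGroupOfForm (conjLocal L (IsCMField.complexConj L) v) (cmLocalForm L N v))) * k) ∂μB ∂μK := by
  haveI : LocallyCompactSpace ↥(unitaryGroupOfForm (conjLocal L (IsCMField.complexConj L) v) (cmLocalForm L N v)) :=
    locallyCompactSpace_local (IsCMField.complexConj L) N _ v
  haveI : SecondCountableTopology ↥(unitaryGroupOfForm (conjLocal L (IsCMField.complexConj L) v) (cmLocalForm L N v)) :=
    secondCountableTopology_local (IsCMField.complexConj L) N _ v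
  haveI : T2Space ↥(unitaryGroupOfForm (conjLocal L (IsCMField.complexConj L) v) (cmLocalForm L N v)) :=
    t2Space_cmDatum_local N L (Matrix.of fun i j : Fin N => if i.val + j.val + 1 = N then (1 : L) else 0) v
  haveI : T1Space (LocalRing L v) := inferInstance
  have hBcl : IsClosed ((cmBorelTriple L N v).P : Set ↥(unitaryGroupOfForm (conjLocal L (IsCMField.complexConj L) v) (cmLocalForm L N v))) :=
    isClosed_borelU (conjLocal L (IsCMField.complexConj L) v) (cmLocalForm L N v)
  obtain ⟨C, hC, hInt⟩ := HaarHK.integral_eq_mul_integral_integral_of_secondCountable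
    (↥(unitaryGroupOfForm (conjLocal L (IsCMField.complexConj L) v) (cmLocalForm L N v))) (cmBorelTriple L N v).P KU hBcl hKUc
    (fun g => by
      obtain ⟨h, κ, hκ, hg⟩ := hGK g
      exact ⟨h, h.2, κ, hκ, hg⟩) ν μB μK
  refine ⟨C, hC, fun F hFc hFs => ?_⟩
  rw [hInt F (hFc.integrable_of_hasCompactSupport hFs)]
  congr 1
  -- Fubini on `↥B × ↥K`
  haveI : CompactSpace ↥KU := isCompact_iff_compactSpace.1 hKUc
  haveI : SecondCountableTopology ↥(cmBorelTriple L N v).P :=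
    inferInstanceAs (SecondCountableTopology ↥(((cmBorelTriple L N v).P : Set ↥(unitaryGroupOfForm (conjLocal L (IsCMField.complexConj L) v) (cmLocalForm L N v)))))
  haveI : SecondCountableTopology ↥KU :=
    inferInstanceAs (SecondCountableTopology ↥((KU : Set ↥(unitaryGroupOfForm (conjLocal L (IsCMField.complexConj L) v) (cmLocalForm L N v)))))
  haveI : BorelSpace (↥(cmBorelTriple L N v).P × ↥KU) := Prod.borelSpace
  haveI : LocallyCompactSpace ↥(cmBorelTriple L N v).P := hBcl.isClosedEmbedding_subtypeVal.locallyCompactSpace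
  haveI : SigmaCompactSpace ↥(cmBorelTriple L N v).P := sigmaCompactSpace_of_locallyCompact_secondCountable
  haveI : SigmaFinite μB := inferInstance
  have hcont : Continuous (Function.uncurry fun (b : ↥(cmBorelTriple L N v).P) (k : ↥KU) =>
      F ((b : ↥(unitaryGroupOfForm (conjLocal L (IsCMField.complexConj L) v) (cmLocalForm L N v))) * k)) :=
    hFc.comp ((continuous_subtype_val.comp continuous_fst).mul (continuous_subtype_val.comp continuous_snd))
  have hSK : IsCompact ((fun q : ↥(unitaryGroupOfForm (conjLocal L (IsCMField.complexConj L) v) (cmLocalForm L N v)) ×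
      ↥(unitaryGroupOfForm (conjLocal L (IsCMField.complexConj L) v) (cmLocalForm L N v)) => q.1 * q.2⁻¹) ''
      (tsupport F ×ˢ (KU : Set ↥(unitaryGroupOfForm (conjLocal L (IsCMField.complexConj L) v) (cmLocalForm L N v))))) :=
    (hFs.prod hKUc).image (continuous_fst.mul continuous_snd.inv)
  have hPpre : IsCompact (((↑) : ↥(cmBorelTriple L N v).P → ↥(unitaryGroupOfForm (conjLocal L (IsCMField.complexConj L) v) (cmLocalForm L N v))) ⁻¹'
      ((fun q : ↥(unitaryGroupOfForm (conjLocal L (IsCMField.complexConj L) v) (cmLocalForm L N v)) ×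
        ↥(unitaryGroupOfForm (conjLocal L (IsCMField.complexConj L) v) (cmLocalForm L N v)) => q.1 * q.2⁻¹) ''
        (tsupport F ×ˢ (KU : Set ↥(unitaryGroupOfForm (conjLocal L (IsCMField.complexConj L) v) (cmLocalForm L N v)))))) :=
    hBcl.isClosedEmbedding_subtypeVal.isCompact_preimage hSK
  have hsupp : HasCompactSupport (Function.uncurry fun (b : ↥(cmBorelTriple L N v).P) (k : ↥KU) =>
      F ((b : ↥(unitaryGroupOfForm (conjLocal L (IsCMField.complexConj L) v) (cmLocalForm L N v))) * k)) := by
    refine HasCompactSupport.intro' (hPpre.prod isCompact_univ) ((hPpre.isClosed).prod isClosed_univ) fun q hq => ?_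
    have hq1 : q.1 ∉ ((↑) : ↥(cmBorelTriple L N v).P → ↥(unitaryGroupOfForm (conjLocal L (IsCMField.complexConj L) v) (cmLocalForm L N v))) ⁻¹'
        ((fun q : ↥(unitaryGroupOfForm (conjLocal L (IsCMField.complexConj L) v) (cmLocalForm L N v)) ×
          ↥(unitaryGroupOfForm (conjLocal L (IsCMField.complexConj L) v) (cmLocalForm L N v)) => q.1 * q.2⁻¹) ''
          (tsupport F ×ˢ (KU : Set ↥(unitaryGroupOfForm (conjLocal L (IsCMField.complexConj L) v) (cmLocalForm L N v))))) :=
      fun h => hq (Set.mk_mem_prod h (Set.mem_univ _))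
    by_contra hne
    apply hq1
    rw [Set.mem_preimage]
    refine ⟨((q.1 : ↥(unitaryGroupOfForm (conjLocal L (IsCMField.complexConj L) v) (cmLocalForm L N v))) * q.2,
      (q.2 : ↥(unitaryGroupOfForm (conjLocal L (IsCMField.complexConj L) v) (cmLocalForm L N v)))), Set.mk_mem_prod (subset_tsupport _ hne) q.2.2, ?_⟩
    simp only [mul_inv_cancel_right]
  exact integral_integral_swap (hcont.integrable_of_hasCompactSupport hsupp)

set_option maxHeartbeats 1600000 in
set_option synthInstance.maxHeartbeats 400000 in
/-- **van Dijk's kernel formula for `i_G(χ)` on `U(Φ_N)(L⁺_v)`**: for a character `χ` of the diagonal torus (no continuity hypothesis is needed: admissibility of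
`cmPrincipalSeries L N v χ` is ★ `isAdmissible_cmPrincipalSeries_of_iwasawa`), a compact open subgroup `K` with `G = B · K`
(e.g. `K = K_v`, ★ `isCompact_isOpen_cmLocalIntegralLevel`, ★ `exists_borel_mul_mem_cmLocalIntegralLevel`) and Haar measures `ν`, `μ_B`, `μ_K`, there is `C > 0` (the `G = B·K`
constant: `∫_G F = C ∫_K ∫_B F(bk)`) with
`(cmPrincipalSeries L N v χ).smoothTrace ν f = ∫_K C · ∫_B f(k⁻¹ b k) · χ(proj b) δ_B^{1∕2}(b) dμ_B dμ_K` for every locally constant compactly supported `f`.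
[cite: vanDijk1972, Thm. p. 237] [cite: BernsteinZelevinsky1977, §2.3] [cite: Rogawski1990, §12.2 p. 173] -/
theorem exists_smoothTrace_cmPrincipalSeries_eq_integral_KB
    (χ : ↥(torusU (conjLocal L (IsCMField.complexConj L) v) (cmLocalForm L N v)) →* ℂˣ)
    (KU : Subgroup ↥(unitaryGroupOfForm (conjLocal L (IsCMField.complexConj L) v) (cmLocalForm L N v)))
    (hKUo : IsOpen (KU : Set ↥(unitaryGroupOfForm (conjLocal L (IsCMField.complexConj L) v) (cmLocalForm L N v))))
    (hKUc : IsCompact (KU : Set ↥(unitaryGroupOfForm (conjLocal L (IsCMField.complexConj L) v) (cmLocalForm L N v))))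
    (hGK : ∀ g : ↥(unitaryGroupOfForm (conjLocal L (IsCMField.complexConj L) v) (cmLocalForm L N v)),
      ∃ h : ↥(cmBorelTriple L N v).P, ∃ κ ∈ KU, g = h * κ)
    (ν : Measure ↥(unitaryGroupOfForm (conjLocal L (IsCMField.complexConj L) v) (cmLocalForm L N v))) [ν.IsHaarMeasure]
    (μB : Measure ↥(cmBorelTriple L N v).P) [μB.IsHaarMeasure] (μK : Measure ↥KU) [μK.IsHaarMeasure] :
    haveI := locallyCompactSpace_cmBorelU L N v
    ∃ C : ℝ, 0 < C ∧
      (∀ F : ↥(unitaryGroupOfForm (conjLocal L (IsCMField.complexConj L) v) (cmLocalForm L N v)) → ℂ, Continuous F → HasCompactSupport F →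
        ∫ g, F g ∂ν = C * ∫ k : ↥KU,
          ∫ b : ↥(cmBorelTriple L N v).P, F ((b : ↥(unitaryGroupOfForm (conjLocal L (IsCMField.complexConj L) v) (cmLocalForm L N v))) * k) ∂μB ∂μK) ∧
      ∀ f : ↥(unitaryGroupOfForm (conjLocal L (IsCMField.complexConj L) v) (cmLocalForm L N v)) → ℂ, IsLocallyConstant f → HasCompactSupport f →
        (cmPrincipalSeries L N v χ).smoothTrace ν f =
          ∫ k : ↥KU,
            (C : ℂ) * ∫ b : ↥(cmBorelTriple L N v).P,
              f ((k : ↥(unitaryGroupOfForm (conjLocal L (IsCMField.complexConj L) v) (cmLocalForm L N v)))⁻¹ * b * k) *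
                (((χ ((cmBorelTriple L N v).proj b) : ℂˣ) : ℂ) * ((rootDeltaChar (cmBorelTriple L N v).P b : ℂˣ) : ℂ)) ∂μB ∂μK := by
  haveI := locallyCompactSpace_cmBorelU L N v
  haveI : LocallyCompactSpace ↥(unitaryGroupOfForm (conjLocal L (IsCMField.complexConj L) v) (cmLocalForm L N v)) :=
    locallyCompactSpace_local (IsCMField.complexConj L) N _ v
  haveI := nonarchimedeanGroup_cmLocal L N v
  obtain ⟨C, hC, hHK⟩ := exists_integral_eq_mul_integral_compact_borel L N v KU hKUc hGK ν μB μK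
  refine ⟨C, hC, hHK, fun f hflc hfcs => ?_⟩
  set σP : Representation ℂ ↥(cmBorelTriple L N v).P ℂ :=
    Representation.twist (((Representation.trivial ℂ ↥(torusU (conjLocal L (IsCMField.complexConj L) v) (cmLocalForm L N v)) ℂ).twist χ).comp
      (cmBorelTriple L N v).proj) (rootDeltaChar (cmBorelTriple L N v).P) with hσP
  have hπ : cmPrincipalSeries L N v χ = Representation.smoothIndRep (cmBorelTriple L N v).P σP := rfl
  have hτ : ∀ p : ↥(cmBorelTriple L N v).P,
      σP p 1 = ((χ ((cmBorelTriple L N v).proj p) : ℂˣ) : ℂ) * ((rootDeltaChar (cmBorelTriple L N v).P p : ℂˣ) : ℂ) := by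
    intro p
    simp only [hσP, Representation.twist_apply, MonoidHom.comp_apply, Representation.trivial_apply, smul_eq_mul, mul_one]
    ring
  -- level, finiteness
  obtain ⟨K₁, hK₁⟩ := exists_isLevel (G := ↥(unitaryGroupOfForm (conjLocal L (IsCMField.complexConj L) v) (cmLocalForm L N v))) (f := f) ⟨hflc, hfcs⟩
  have hK'f : IsLevel (K₁ ⊓ KU) f := hK₁.inf_left (IsLevel.indicator hKUo hKUc)
  haveI : CompactSpace ↥KU := isCompact_iff_compactSpace.1 hKUc
  have hK'o' : IsOpen ((((K₁ ⊓ KU).subgroupOf KU) : Subgroup ↥KU) : Set ↥KU) := by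
    rw [Subgroup.coe_subgroupOf]; exact hK'f.isOpen.preimage continuous_subtype_val
  haveI : Fintype (↥KU ⧸ (K₁ ⊓ KU).subgroupOf KU) := by
    haveI := Subgroup.quotient_finite_of_isOpen _ hK'o'
    exact Fintype.ofFinite _
  have hK'c' := (Subgroup.isClosed_of_isOpen _ hK'o').isCompact
  have hadm : (Representation.smoothIndRep (cmBorelTriple L N v).P σP).IsAdmissible := by
    rw [← hπ]; exact isAdmissible_cmPrincipalSeries_of_iwasawa L N v (exists_borel_mul_mem_cmLocalIntegralLevel L N v) χ
  haveI : μB.IsMulLeftInvariant := inferInstance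
  rw [hπ, Representation.smoothTrace_smoothIndRep_eq_integral_kernel_diag (H := (cmBorelTriple L N v).P) (K := KU) (σ := σP)
    (K' := K₁ ⊓ KU) (μ := ν) μB μK (C : ℂ) (fun Fn hFc hFs => by rw [hHK Fn hFc hFs]) inf_le_right hK'c' hGK hadm hfcs hflc hK'f]
  refine integral_congr_ae (Filter.Eventually.of_forall fun k => ?_)
  simp only
  congr 1
  refine integral_congr_ae (Filter.Eventually.of_forall fun b => ?_)
  simp only [hτ]

end UnitaryGroup

end Literature.NumberTheory.Automorphic

end
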